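import Literature.MathematicalPhysics.QuantumFieldTheory.Balaban1983to89.Beta.SecondOrderResponse

/-!
# `BalabanUV.Beta.FP.FFPerturbationSandwichNull` — road «FP» for binder row D1, row **N2a-ENG v2** (owner d1-p3, `N2B-DESIGN.md` v1.3 §7, journal l.32289;
# OWNER WORD l.32887 «`D m = D_E m` ENTIRELY»), a PRECISION to the generic word list (leaf-06 g14 INTENT 3, `FP/FFPerturbationCarrier` ∕ `FP/FFPerturbationHessWords`,
# journal l.32955 ∕ l.32992): OF THE THREE SANDWICH WORDS `A∘D∘E`, `E∘D∘A`, `E∘D∘E` BY WHICH AN ff-SUPPORTED PERTURBATION `E` ENTERS an1's CARRIER `W2OfK`,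
# TWO ARE `dM`-NULL IDENTICALLY AND THE THIRD HAS NO MULTIPLIER COLUMN — the background derivative `dM` reads a kernel ONLY through its `(μ, y)`-COLUMNS
# (`colH`, `colM`: second fibre index `inr μ`), and a word ENDING in `E` has no such column; a word BEGINNING with `E` has no multiplier ROWS.  Hence
# `dM (A∘D∘E + E∘D∘A + E∘D∘E) N S M μ y = vertexOfK (E∘D∘A) N S μ y`: ONE word, field rows only, for every `D`, with NO summability letter (termwise zeros).

HONEST DEPENDENCY (page 1, mandatory): continuum YM on T⁴ ⇐ BetaPertH ∧ nine spine estimates (0/9 proved); BetaPertH ⇐ (D1) ∧ (D4) ∧ CAP+tail;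
G-an2-4 gates asym, D1 and NE2/3/4.  HONEST FRAMING (cell contract, verbatim): «discharging `BetaPertH` makes Bałaban's UV stability UNCONDITIONAL —
a real constructive-QFT result; it is NOT the continuum limit and NOT the Clay problem.»  THIS MODULE is [folklore] termwise bookkeeping over an1's
`SecondOrderResponse` (`colM`, `vertexOfM`, `dM`) and an4's `OneStepKernelFamily` (`colH`, `vertexOfK`) BY NAME; GENERIC `d`, `N`, GENERIC kernels — NOTHING of
the perfect objects is instantiated; no `def`, no `def … : Prop`, nothing cited, 0 sorry; every hypothesis is a displayed block letter of `E`.  0∕4 row-D1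
binders; NOT N2a (a count inside the generic half of its word list), NOT SDF, NOT D1, NOT BetaPertH, NOT continuum, NOT Clay.  «not in print; our bookkeeping».

ABSOLUTE RULE (cell charter, verbatim): «No internally-minted statement may enter as a cited fact. Every hypothesis is either kernel-proved in this
package or a verbatim quotation of a PUBLISHED theorem with page reference. The manuscript(s) under audit are NOT citable for their own disputed steps —
they are the thing under adjudication; programme-internal (2001/route/tribunal) claims are never citable.»

CONTENT (all [folklore], all termwise — no `Summable`, no `Decays`):
* §1 columns are congruence data: `vertexOfK_congr_colH`, `vertexOfM_congr_colM`, `dM_congr`; zero columns give zero vertices: `vertexOfK_eq_zero_of_colH`,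
  `vertexOfM_eq_zero_of_colM`.
* §2 words ENDING in `E` (letters (fm) `E x y (inl κ) (inr μ) = 0`, (mm) `E x y (inr ρ) (inr μ) = 0`): `colH_comp_right_null`, `colM_comp_right_null`,
  **`dM_comp_right_null : dM (comp X E) N S M μ y = 0`** for EVERY `X`; instances `dM_sandwich_ADE_null`, `dM_sandwich_EDE_null`.
* §3 words BEGINNING with `E` (letters (mf) `E x y (inr ρ) (inl κ) = 0`, (mm)): `colM_comp_left_null`, `colM_comp_comp_left_null`,
  **`vertexOfM_sandwich_EDA_null`**, **`dM_sandwich_EDA_eq_vertexOfK : dM (comp (comp E D) A) N S M μ y = vertexOfK (comp (comp E D) A) N S μ y`**.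
* §4 **`dM_sandwich_words_eq_one`**: `dM (comp (comp A D) E + comp (comp E D) A + comp (comp E D) E) N S M μ y = vertexOfK (comp (comp E D) A) N S μ y` —
  the right-hand side of leaf-06's `W2OfK_add_words` ∕ `W2SymOfK_add_words` collapses to ONE field-row word per ordering; consequently the `hessKer` word list
  of an ff-supported perturbation is: tadpole-outer 1, sandwich 1 per ordering of the symmetrised carrier (+ its `E`-outer companion), bubble 2+1.
NOT HERE (honest): the carrier identity itself (leaf-06 FILE A∕B), any perfect object, any bound.
Unit `b2b-balaban-beta-d1-formalise-leaf-01` (gen 16), D1 formalisation swarm; `LEAVES-FP.md` row «N2a-ENG v2» (precision to the generic word list).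
-/

noncomputable section

namespace Summit.QuantumFields.BalabanUV.Beta.FP.FFPerturbationSandwichNull

open Finset
open scoped BigOperators
open Literature.MathematicalPhysics.QuantumFieldTheory.Balaban1983to89
open Literature.MathematicalPhysics.QuantumFieldTheory.Balaban1983to89.Beta
open ExpKernelCalculus (MKer comp)
open OneStepResolventKernel (Fib wsum)
open OneStepKernelFamily (colH vertexOfK)
open InterLevelTransport (onLat cwsum)
open SecondOrderResponse (colM vertexOfM dM)

variable {d : ℕ} {N : ℕ}

/-! ## §1 The columns are congruence data for the vertices -/

/-- [folklore] `vertexOfK` reads `K` only through its `ℋ`-columns. -/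
theorem vertexOfK_congr_colH {K K' : MKer (d + 1) (Fib d)} (h : ∀ μ y κ' u, colH K N μ y κ' u = colH K' N μ y κ' u)
    (S : Fin (d + 1) → (Fin (d + 1) → ℤ) → MKer (d + 1) (Fib d)) (μ : Fin (d + 1)) (y : Fin (d + 1) → ℤ) :
    vertexOfK K N S μ y = vertexOfK K' N S μ y := by
  funext x z a b
  simp only [vertexOfK, wsum, h]

/-- [folklore] `vertexOfM` reads `K` only through its multiplier columns. -/
theorem vertexOfM_congr_colM {K K' : MKer (d + 1) (Fib d)} (h : ∀ μ y ρ w, colM K N μ y ρ w = colM K' N μ y ρ w)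
    (M : Fin (d + 1) → (Fin (d + 1) → ℤ) → MKer (d + 1) (Fib d)) (μ : Fin (d + 1)) (y : Fin (d + 1) → ℤ) :
    vertexOfM K N M μ y = vertexOfM K' N M μ y := by
  funext x z a b
  have hc : ∀ ρ, colM K N μ y ρ = colM K' N μ y ρ := fun ρ => funext fun w => h μ y ρ w
  simp only [vertexOfM, hc]

/-- [folklore] `dM` reads `K` only through its two column families. -/
theorem dM_congr {K K' : MKer (d + 1) (Fib d)} (hH : ∀ μ y κ' u, colH K N μ y κ' u = colH K' N μ y κ' u)
    (hM : ∀ μ y ρ w, colM K N μ y ρ w = colM K' N μ y ρ w)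
    (S M : Fin (d + 1) → (Fin (d + 1) → ℤ) → MKer (d + 1) (Fib d)) (μ : Fin (d + 1)) (y : Fin (d + 1) → ℤ) :
    dM K N S M μ y = dM K' N S M μ y := by
  unfold dM
  rw [vertexOfK_congr_colH hH S μ y, vertexOfM_congr_colM hM M μ y]

/-- [folklore] Zero `ℋ`-columns ⟹ zero field vertex. -/
theorem vertexOfK_eq_zero_of_colH {K : MKer (d + 1) (Fib d)} (h : ∀ μ y κ' u, colH K N μ y κ' u = 0)
    (S : Fin (d + 1) → (Fin (d + 1) → ℤ) → MKer (d + 1) (Fib d)) (μ : Fin (d + 1)) (y : Fin (d + 1) → ℤ) :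
    vertexOfK K N S μ y = 0 := by
  funext x z a b
  simp only [vertexOfK, wsum, h, zero_mul, tsum_zero, Finset.sum_const_zero, Pi.zero_apply]

/-- [folklore] Zero multiplier columns ⟹ zero multiplier vertex. -/
theorem vertexOfM_eq_zero_of_colM {K : MKer (d + 1) (Fib d)} (h : ∀ μ y ρ w, colM K N μ y ρ w = 0)
    (M : Fin (d + 1) → (Fin (d + 1) → ℤ) → MKer (d + 1) (Fib d)) (μ : Fin (d + 1)) (y : Fin (d + 1) → ℤ) :
    vertexOfM K N M μ y = 0 := by
  funext x z a b
  have hc : ∀ ρ, colM K N μ y ρ = 0 := fun ρ => funext fun w => h μ y ρ w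
  have hon : ∀ ρ, onLat N (colM K N μ y ρ) = fun _ => (0 : ℝ) := by
    intro ρ; funext v; simp only [hc, onLat]; split_ifs <;> rfl
  simp only [vertexOfM, cwsum, wsum, hon, zero_mul, tsum_zero, Finset.sum_const_zero, Pi.zero_apply]

/-- [folklore] Zero columns of both kinds ⟹ `dM K = 0`. -/
theorem dM_eq_zero_of_cols {K : MKer (d + 1) (Fib d)} (hH : ∀ μ y κ' u, colH K N μ y κ' u = 0) (hM : ∀ μ y ρ w, colM K N μ y ρ w = 0)
    (S M : Fin (d + 1) → (Fin (d + 1) → ℤ) → MKer (d + 1) (Fib d)) (μ : Fin (d + 1)) (y : Fin (d + 1) → ℤ) :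
    dM K N S M μ y = 0 := by
  unfold dM
  rw [vertexOfK_eq_zero_of_colH hH S μ y, vertexOfM_eq_zero_of_colM hM M μ y, add_zero]

/-! ## §2 Words ENDING in `E`: no `(μ, y)`-column at all -/

section RightNull

variable {E : MKer (d + 1) (Fib d)}

/-- [folklore] The `inr μ`-column of `E` vanishes on EVERY row fibre (letters (fm) + (mm)). -/
theorem col_inr_eq_zero (hfm : ∀ x y (κ μ : Fin (d + 1)), E x y (Sum.inl κ) (Sum.inr μ) = 0)
    (hmm : ∀ x y (ρ μ : Fin (d + 1)), E x y (Sum.inr ρ) (Sum.inr μ) = 0) (x y : Fin (d + 1) → ℤ) (f : Fib d) (μ : Fin (d + 1)) :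
    E x y f (Sum.inr μ) = 0 := by
  cases f with
  | inl κ => exact hfm x y κ μ
  | inr ρ => exact hmm x y ρ μ

/-- [folklore] **A WORD ENDING IN `E` HAS NO `ℋ`-COLUMN**: `colH (X∘E) = 0` for every `X`. -/
theorem colH_comp_right_null (hfm : ∀ x y (κ μ : Fin (d + 1)), E x y (Sum.inl κ) (Sum.inr μ) = 0)
    (hmm : ∀ x y (ρ μ : Fin (d + 1)), E x y (Sum.inr ρ) (Sum.inr μ) = 0) (X : MKer (d + 1) (Fib d))
    (μ : Fin (d + 1)) (y : Fin (d + 1) → ℤ) (κ' : Fin (d + 1)) (u : Fin (d + 1) → ℤ) : colH (comp X E) N μ y κ' u = 0 := by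
  simp only [colH, comp, col_inr_eq_zero hfm hmm, mul_zero, Finset.sum_const_zero, tsum_zero]

/-- [folklore] **A WORD ENDING IN `E` HAS NO MULTIPLIER COLUMN**: `colM (X∘E) = 0` for every `X`. -/
theorem colM_comp_right_null (hfm : ∀ x y (κ μ : Fin (d + 1)), E x y (Sum.inl κ) (Sum.inr μ) = 0)
    (hmm : ∀ x y (ρ μ : Fin (d + 1)), E x y (Sum.inr ρ) (Sum.inr μ) = 0) (X : MKer (d + 1) (Fib d))
    (μ : Fin (d + 1)) (y : Fin (d + 1) → ℤ) (ρ : Fin (d + 1)) (w : Fin (d + 1) → ℤ) : colM (comp X E) N μ y ρ w = 0 := by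
  simp only [colM, comp, col_inr_eq_zero hfm hmm, mul_zero, Finset.sum_const_zero, tsum_zero]

/-- [folklore] **`dM` OF A WORD ENDING IN `E` VANISHES IDENTICALLY**, for every prefix `X` and all tables `S`, `M`. -/
theorem dM_comp_right_null (hfm : ∀ x y (κ μ : Fin (d + 1)), E x y (Sum.inl κ) (Sum.inr μ) = 0)
    (hmm : ∀ x y (ρ μ : Fin (d + 1)), E x y (Sum.inr ρ) (Sum.inr μ) = 0) (X : MKer (d + 1) (Fib d))
    (S M : Fin (d + 1) → (Fin (d + 1) → ℤ) → MKer (d + 1) (Fib d)) (μ : Fin (d + 1)) (y : Fin (d + 1) → ℤ) :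
    dM (comp X E) N S M μ y = 0 :=
  dM_eq_zero_of_cols (colH_comp_right_null hfm hmm X) (colM_comp_right_null hfm hmm X) S M μ y

/-- [folklore] The single-`E` sandwich word `A∘D∘E` is `dM`-null. -/
theorem dM_sandwich_ADE_null (hfm : ∀ x y (κ μ : Fin (d + 1)), E x y (Sum.inl κ) (Sum.inr μ) = 0)
    (hmm : ∀ x y (ρ μ : Fin (d + 1)), E x y (Sum.inr ρ) (Sum.inr μ) = 0) (A D : MKer (d + 1) (Fib d))
    (S M : Fin (d + 1) → (Fin (d + 1) → ℤ) → MKer (d + 1) (Fib d)) (μ : Fin (d + 1)) (y : Fin (d + 1) → ℤ) :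
    dM (comp (comp A D) E) N S M μ y = 0 :=
  dM_comp_right_null hfm hmm (comp A D) S M μ y

/-- [folklore] The double-`E` sandwich word `E∘D∘E` is `dM`-null. -/
theorem dM_sandwich_EDE_null (hfm : ∀ x y (κ μ : Fin (d + 1)), E x y (Sum.inl κ) (Sum.inr μ) = 0)
    (hmm : ∀ x y (ρ μ : Fin (d + 1)), E x y (Sum.inr ρ) (Sum.inr μ) = 0) (D : MKer (d + 1) (Fib d))
    (S M : Fin (d + 1) → (Fin (d + 1) → ℤ) → MKer (d + 1) (Fib d)) (μ : Fin (d + 1)) (y : Fin (d + 1) → ℤ) :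
    dM (comp (comp E D) E) N S M μ y = 0 :=
  dM_comp_right_null hfm hmm (comp E D) S M μ y

end RightNull

/-! ## §3 Words BEGINNING with `E`: no multiplier ROWS -/

section LeftNull

variable {E : MKer (d + 1) (Fib d)}

/-- [folklore] The `inr ρ`-row of `E` vanishes on EVERY column fibre (letters (mf) + (mm)). -/
theorem row_inr_eq_zero (hmf : ∀ x y (ρ κ : Fin (d + 1)), E x y (Sum.inr ρ) (Sum.inl κ) = 0)
    (hmm : ∀ x y (ρ μ : Fin (d + 1)), E x y (Sum.inr ρ) (Sum.inr μ) = 0) (x y : Fin (d + 1) → ℤ) (ρ : Fin (d + 1)) (f : Fib d) :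
    E x y (Sum.inr ρ) f = 0 := by
  cases f with
  | inl κ => exact hmf x y ρ κ
  | inr μ => exact hmm x y ρ μ

/-- [folklore] A word BEGINNING with `E` has no multiplier rows: `(E∘Y) x z (inr ρ) b = 0`. -/
theorem comp_left_inr_row_null (hmf : ∀ x y (ρ κ : Fin (d + 1)), E x y (Sum.inr ρ) (Sum.inl κ) = 0)
    (hmm : ∀ x y (ρ μ : Fin (d + 1)), E x y (Sum.inr ρ) (Sum.inr μ) = 0) (Y : MKer (d + 1) (Fib d))
    (x z : Fin (d + 1) → ℤ) (ρ : Fin (d + 1)) (b : Fib d) : comp E Y x z (Sum.inr ρ) b = 0 := by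
  simp only [comp, row_inr_eq_zero hmf hmm, zero_mul, Finset.sum_const_zero, tsum_zero]

/-- [folklore] **A WORD BEGINNING WITH `E` HAS NO MULTIPLIER COLUMN**: `colM (E∘Y) = 0`. -/
theorem colM_comp_left_null (hmf : ∀ x y (ρ κ : Fin (d + 1)), E x y (Sum.inr ρ) (Sum.inl κ) = 0)
    (hmm : ∀ x y (ρ μ : Fin (d + 1)), E x y (Sum.inr ρ) (Sum.inr μ) = 0) (Y : MKer (d + 1) (Fib d))
    (μ : Fin (d + 1)) (y : Fin (d + 1) → ℤ) (ρ : Fin (d + 1)) (w : Fin (d + 1) → ℤ) : colM (comp E Y) N μ y ρ w = 0 :=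
  comp_left_inr_row_null hmf hmm Y _ _ ρ _

/-- [folklore] The same one bracket further out: `colM ((E∘D)∘A) = 0`. -/
theorem colM_comp_comp_left_null (hmf : ∀ x y (ρ κ : Fin (d + 1)), E x y (Sum.inr ρ) (Sum.inl κ) = 0)
    (hmm : ∀ x y (ρ μ : Fin (d + 1)), E x y (Sum.inr ρ) (Sum.inr μ) = 0) (D A : MKer (d + 1) (Fib d))
    (μ : Fin (d + 1)) (y : Fin (d + 1) → ℤ) (ρ : Fin (d + 1)) (w : Fin (d + 1) → ℤ) : colM (comp (comp E D) A) N μ y ρ w = 0 := by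
  simp only [colM, comp, row_inr_eq_zero hmf hmm, zero_mul, Finset.sum_const_zero, tsum_zero]

/-- [folklore] **THE SURVIVING SANDWICH WORD HAS NO MULTIPLIER VERTEX**: `vertexOfM ((E∘D)∘A) N M μ y = 0`. -/
theorem vertexOfM_sandwich_EDA_null (hmf : ∀ x y (ρ κ : Fin (d + 1)), E x y (Sum.inr ρ) (Sum.inl κ) = 0)
    (hmm : ∀ x y (ρ μ : Fin (d + 1)), E x y (Sum.inr ρ) (Sum.inr μ) = 0) (D A : MKer (d + 1) (Fib d))
    (M : Fin (d + 1) → (Fin (d + 1) → ℤ) → MKer (d + 1) (Fib d)) (μ : Fin (d + 1)) (y : Fin (d + 1) → ℤ) :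
    vertexOfM (comp (comp E D) A) N M μ y = 0 :=
  vertexOfM_eq_zero_of_colM (colM_comp_comp_left_null hmf hmm D A) M μ y

/-- [folklore] **`dM` OF THE SURVIVING SANDWICH WORD IS ITS FIELD VERTEX ALONE**: `dM ((E∘D)∘A) N S M μ y = vertexOfK ((E∘D)∘A) N S μ y`. -/
theorem dM_sandwich_EDA_eq_vertexOfK (hmf : ∀ x y (ρ κ : Fin (d + 1)), E x y (Sum.inr ρ) (Sum.inl κ) = 0)
    (hmm : ∀ x y (ρ μ : Fin (d + 1)), E x y (Sum.inr ρ) (Sum.inr μ) = 0) (D A : MKer (d + 1) (Fib d))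
    (S M : Fin (d + 1) → (Fin (d + 1) → ℤ) → MKer (d + 1) (Fib d)) (μ : Fin (d + 1)) (y : Fin (d + 1) → ℤ) :
    dM (comp (comp E D) A) N S M μ y = vertexOfK (comp (comp E D) A) N S μ y := by
  unfold dM
  rw [vertexOfM_sandwich_EDA_null hmf hmm D A M μ y, add_zero]

end LeftNull

/-! ## §4 The three sandwich words are ONE word under `dM` -/

/-- [folklore] **THE SANDWICH WORDS OF AN ff-SUPPORTED PERTURBATION COLLAPSE TO ONE FIELD-ROW WORD UNDER `dM`**: for `E` with the three block letters
(fm) `E x y (inl κ) (inr μ) = 0`, (mf) `E x y (inr ρ) (inl κ) = 0`, (mm) `E x y (inr ρ) (inr μ) = 0`, every `A`, `D` and all tables `S`, `M`,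
`dM (A∘D∘E + E∘D∘A + E∘D∘E) N S M μ y = vertexOfK (E∘D∘A) N S μ y` — TERMWISE (columns add pointwise; the `E`-ending words have zero columns;
the `E`-beginning word has zero multiplier columns), NO summability letter.  This is the right-hand side of leaf-06 g14's `W2OfK_add_words` at
`D := dM A N S M ν y'`. -/
theorem dM_sandwich_words_eq_one {E : MKer (d + 1) (Fib d)} (hfm : ∀ x y (κ μ : Fin (d + 1)), E x y (Sum.inl κ) (Sum.inr μ) = 0)
    (hmf : ∀ x y (ρ κ : Fin (d + 1)), E x y (Sum.inr ρ) (Sum.inl κ) = 0) (hmm : ∀ x y (ρ μ : Fin (d + 1)), E x y (Sum.inr ρ) (Sum.inr μ) = 0)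
    (A D : MKer (d + 1) (Fib d)) (S M : Fin (d + 1) → (Fin (d + 1) → ℤ) → MKer (d + 1) (Fib d)) (μ : Fin (d + 1)) (y : Fin (d + 1) → ℤ) :
    dM (comp (comp A D) E + comp (comp E D) A + comp (comp E D) E) N S M μ y = vertexOfK (comp (comp E D) A) N S μ y := by
  have hH : ∀ μ y κ' u, colH (comp (comp A D) E + comp (comp E D) A + comp (comp E D) E) N μ y κ' u = colH (comp (comp E D) A) N μ y κ' u := by
    intro μ y κ' u
    have h1 := colH_comp_right_null (N := N) hfm hmm (comp A D) μ y κ' u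
    have h3 := colH_comp_right_null (N := N) hfm hmm (comp E D) μ y κ' u
    simp only [colH, Pi.add_apply] at h1 h3 ⊢
    rw [h1, h3, zero_add, add_zero]
  have hM : ∀ μ y ρ w, colM (comp (comp A D) E + comp (comp E D) A + comp (comp E D) E) N μ y ρ w = colM (comp (comp E D) A) N μ y ρ w := by
    intro μ y ρ w
    have h1 := colM_comp_right_null (N := N) hfm hmm (comp A D) μ y ρ w
    have h3 := colM_comp_right_null (N := N) hfm hmm (comp E D) μ y ρ w
    simp only [colM, Pi.add_apply] at h1 h3 ⊢
    rw [h1, h3, zero_add, add_zero]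
  rw [dM_congr hH hM S M μ y, dM_sandwich_EDA_eq_vertexOfK hmf hmm D A S M μ y]

/-- [folklore] The same with the three words NEGATED and grouped as leaf-06's `W2OfK_add_words` subtracts them:
`dM (-(A∘D∘E + E∘D∘A + E∘D∘E)) N S M μ y = -vertexOfK (E∘D∘A) N S μ y`. -/
theorem dM_neg_sandwich_words_eq_one {E : MKer (d + 1) (Fib d)} (hfm : ∀ x y (κ μ : Fin (d + 1)), E x y (Sum.inl κ) (Sum.inr μ) = 0)
    (hmf : ∀ x y (ρ κ : Fin (d + 1)), E x y (Sum.inr ρ) (Sum.inl κ) = 0) (hmm : ∀ x y (ρ μ : Fin (d + 1)), E x y (Sum.inr ρ) (Sum.inr μ) = 0)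
    (A D : MKer (d + 1) (Fib d)) (S M : Fin (d + 1) → (Fin (d + 1) → ℤ) → MKer (d + 1) (Fib d)) (μ : Fin (d + 1)) (y : Fin (d + 1) → ℤ) :
    dM (-(comp (comp A D) E + comp (comp E D) A + comp (comp E D) E)) N S M μ y = -vertexOfK (comp (comp E D) A) N S μ y := by
  have hH : ∀ μ y κ' u, colH (-(comp (comp A D) E + comp (comp E D) A + comp (comp E D) E)) N μ y κ' u = colH (-comp (comp E D) A) N μ y κ' u := by
    intro μ y κ' u
    have h1 := colH_comp_right_null (N := N) hfm hmm (comp A D) μ y κ' u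
    have h3 := colH_comp_right_null (N := N) hfm hmm (comp E D) μ y κ' u
    simp only [colH, Pi.add_apply, Pi.neg_apply] at h1 h3 ⊢
    rw [h1, h3, zero_add, add_zero]
  have hM : ∀ μ y ρ w, colM (-(comp (comp A D) E + comp (comp E D) A + comp (comp E D) E)) N μ y ρ w = colM (-comp (comp E D) A) N μ y ρ w := by
    intro μ y ρ w
    have h1 := colM_comp_right_null (N := N) hfm hmm (comp A D) μ y ρ w
    have h3 := colM_comp_right_null (N := N) hfm hmm (comp E D) μ y ρ w
    simp only [colM, Pi.add_apply, Pi.neg_apply] at h1 h3 ⊢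
    rw [h1, h3, zero_add, add_zero]
  have hM0 : ∀ μ y ρ w, colM (-comp (comp E D) A) N μ y ρ w = 0 := by
    intro μ y ρ w
    have h2 := colM_comp_comp_left_null (N := N) hmf hmm D A μ y ρ w
    simp only [colM, Pi.neg_apply] at h2 ⊢
    rw [h2, neg_zero]
  have hHn : ∀ μ y κ' u, colH (-comp (comp E D) A) N μ y κ' u = -colH (comp (comp E D) A) N μ y κ' u := fun _ _ _ _ => rfl
  rw [dM_congr hH hM S M μ y]
  unfold dM
  rw [vertexOfM_eq_zero_of_colM hM0 M μ y, add_zero]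
  funext x z a b
  simp only [vertexOfK, wsum, hHn, neg_mul, tsum_neg, Finset.sum_neg_distrib, Pi.neg_apply]

end Summit.QuantumFields.BalabanUV.Beta.FP.FFPerturbationSandwichNull

end
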